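import Mathlib
import Literature.NumberTheory.LFunctions.Zhang2022.Section5DeltaAnalytic
import HarnessLib

/-!
# Zhang (2022), §5, Lemma 5.4 (i): "Using partial integration twice … `δ(s) = (1/(s(s+1)))∫₀^∞
# Δ″(x)x^{s+1} dx`" and "some upper bounds for `Δ″(x)` analogous to Lemma 5.3" — the contour shift
# of (5.12) for `Δ^{(n)}`, its super-polynomial decay, the two partial integrations, and the
# structural bound `‖δ(s)‖ ≤ K/‖s‖²` on `1/2 ≤ σ ≤ 2`, kernel-checked

Topic `Literature/NumberTheory/LFunctions/Zhang2022` (Landau–Siegel autopsy tree; verdict-neutral).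
Y. Zhang, *Discrete mean estimates and the Landau–Siegel zero*, arXiv:2211.02515v1 (2022) — **an
unrefereed manuscript, a claimed result under adjudication** (cell pub-zhang: audit + repair census
of arXiv:2211.02515; no claim about Landau–Siegel).

Glossary: `\l` = `𝓛 = log D`; `𝓛₂ = 𝓛^{400}` ((2.15)); `s₀ = 1/2 + 2πit₀`; `Δ` is (5.10)
(`Lemma53.Delta510`); `Δ^{(n)}(x) = ∫ (−2πi(e^u−1))ⁿ e^{phase(x,u)} du` (`Lemma53.phaseInt n`,
`Section5Lemma54DeltaDeriv`: `Δ′ = phaseInt 1`, `Δ″ = phaseInt 2`). Source text, §5 p. 11: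

> Proof. (i). Using partial integration twice we obtain `δ(s) = (1/(s(s+1)))∫₀^∞ Δ″(x)x^{s+1} ds`.
> By (5.10) we have `Δ″(x) = −4π²∫(e^u−1)² exp{s₀u − B²u² − 2πix(e^u−1)} du`.
> Thus some upper bounds for `Δ″(x)` analogous to Lemma 5.3 can be obtained, and (i) follows.

This file PROVES the "analogous upper bounds" for every order `n` (free reals `L₂ ≥ 1`, `t₀`,
`x ≥ 0`), by the contour `L′₁ ∪ L′₂ ∪ L′₃` of (5.12) applied to the integrand
`(−2πi(e^w−1))ⁿ e^{phase(w)}` (`|−2πi(e^w − 1)| ≤ 2π(e^u + 1)` on `Re w = u`):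

* `Lemma53.phaseInt_eq_contour` — "By Cauchy's theorem" for `Δ^{(n)}` (rectangle `[a,R]×[−1/L₂,0]`,
  `R → ∞`);
* `Lemma53.norm_phaseInt_le_caseTwo` — the analogue of (5.9):
  `‖Δ^{(n)}(x)‖ ≤ 2(4π)ⁿe^{−(cL₂ log x)²} + (4π)ⁿe^{1−(cL₂ log x)²}/L₂ + e·Jₙ·e^{−X/L₂}`,
  `Jₙ = ∫(2π(e^u+1))ⁿe^{u/2−L₂²u²} du`, under `a = −c log x ≤ 0`, `0 < X ≤ xe^{a}`, `2t₀ < X`;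
* `Lemma53.norm_phaseInt_le` — the trivial bound `‖Δ^{(n)}(x)‖ ≤ Jₙ` for all `x`;
* `Lemma53.exists_norm_phaseInt_le_rpow_neg` — super-polynomial decay `‖Δ^{(n)}(x)‖ ≤ C x^{−k}`,
  `x ≥ 1`; `Lemma53.integrableOn_norm_phaseInt_mul_rpow` — `∫₀^∞ ‖Δ^{(n)}(x)‖ x^{a−1} dx < ∞`
  for `a > 0`; `Lemma53.integrableOn_phaseInt_mul_cpow` — `Δ^{(n)}(x)x^{s−1} ∈ L¹(0,∞)`, `σ > 0`;
* `Lemma53.integral_phaseInt_mul_cpow_eq` — ONE partial integration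
  `∫₀^∞ Δ^{(n)}x^{s−1} = −(1/s)∫₀^∞ Δ^{(n+1)}x^{s}` (`σ > 0`; Mathlib's
  `integral_Ioi_mul_deriv_eq_deriv_mul`, boundary terms `→ 0` at `0⁺` and `∞`);
* `Lemma53.delta514_eq` — **"Using partial integration twice we obtain
  `δ(s) = (1/(s(s+1)))∫₀^∞ Δ″(x)x^{s+1} dx`"** (source prints `ds`), for every `σ > 0`
  (`Δ″ = phaseInt 2` by `deriv_deriv_Delta510`);
* `Lemma53.norm_delta514_le` — **Lemma 5.4 (i), structural form**: for `1/2 ≤ σ ≤ 2`,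
  `‖δ(s)‖ ≤ K/‖s‖²`, `K = ∫₀^∞ ‖Δ″(x)‖(x^{3/2} + x³) dx < ∞` independent of `s`.

What is NOT asserted: the size `K ≪ 𝓛^c` under the manuscript's parameter values
(`𝓛₂ = 𝓛^{400}`, `t₀`), i.e. the implied constant of "`δ(s) ≪ 𝓛^c|s|^{−2}`"; the manuscript's
parameter values are not introduced. Nothing about Theorems 1–2 of the source is stated or
implied; nothing here bears on the cell's verdict on (8.24).

## References

* Y. Zhang, arXiv:2211.02515v1 (2022), §5 p. 11, Lemma 5.4 (i) and its proof, (5.12)–(5.14).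
  [cite: Zhang2022LandauSiegel, §5 Lemma 5.4 (i)]
-/

noncomputable section

open Complex Real Set MeasureTheory Filter Topology intervalIntegral

namespace Literature.NumberTheory.LFunctions.Zhang2022

namespace Lemma53

/-! ## The factor `−2πi(e^w − 1)` on the contour -/

/-- The entire extension of `dfac`: `−2πi(e^w − 1)` for complex `w`.
[cite: Zhang2022LandauSiegel, §5 Lemma 5.4 (proof)] -/
def dfacC (w : ℂ) : ℂ := -(2 * π * I * (cexp w - 1))

/-- Unfolding lemma. [cite: Zhang2022LandauSiegel, §5 Lemma 5.4 (proof)] -/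
lemma dfacC_def (w : ℂ) : dfacC w = -(2 * π * I * (cexp w - 1)) := rfl

/-- On the real axis `dfacC` is `dfac`. [cite: Zhang2022LandauSiegel, §5 Lemma 5.4 (proof)] -/
lemma dfacC_ofReal (u : ℝ) : dfacC (u : ℂ) = dfac u := rfl

/-- `|−2πi(e^{u+iv} − 1)| ≤ 2π(e^u + 1)`. [folklore] -/
private lemma norm_dfacC_le (u v : ℝ) : ‖dfacC (u + v * I)‖ ≤ 2 * π * (Real.exp u + 1) := by
  rw [dfacC_def, norm_neg]
  have h1 : ‖cexp ((u : ℂ) + v * I) - 1‖ ≤ Real.exp u + 1 := by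
    calc ‖cexp ((u : ℂ) + v * I) - 1‖ ≤ ‖cexp ((u : ℂ) + v * I)‖ + ‖(1 : ℂ)‖ := norm_sub_le _ _
      _ = Real.exp u + 1 := by
          rw [Complex.norm_exp, norm_one]
          simp
  calc ‖2 * π * I * (cexp ((u : ℂ) + v * I) - 1)‖ = 2 * π * ‖cexp ((u : ℂ) + v * I) - 1‖ := by
        simp [Complex.norm_real, Real.norm_eq_abs, abs_of_pos Real.pi_pos]
    _ ≤ 2 * π * (Real.exp u + 1) := by gcongr

/-- For `u ≤ 0`: `2π(e^u + 1) ≤ 4π`. [folklore] -/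
private lemma two_pi_mul_exp_add_one_le {u : ℝ} (hu : u ≤ 0) : 2 * π * (Real.exp u + 1) ≤ 4 * π := by
  have : Real.exp u ≤ 1 := Real.exp_le_one_iff.mpr hu
  nlinarith [Real.pi_pos]

/-- The integrand `(−2πi(e^w−1))ⁿ e^{phase(w)}` is entire. [folklore] -/
private lemma differentiable_integrand (L₂ t₀ x : ℝ) (n : ℕ) :
    Differentiable ℂ fun w : ℂ => dfacC w ^ n * cexp (phase L₂ t₀ x w) := by
  unfold dfacC phase
  fun_prop

/-! ## Integrability on horizontal lines and the far side -/

/-- The shifted integrand on `Im w = v ∈ [−1, 0]` is integrable in `u` (`L₂ ≠ 0`, `x ≥ 0`).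
[cite: Zhang2022LandauSiegel, §5 (5.12), Lemma 5.4 (proof)] -/
theorem integrable_dfacC_pow_mul_cexp_phase_shift {L₂ : ℝ} (hL : L₂ ≠ 0) (t₀ : ℝ) {x v : ℝ}
    (hx : 0 ≤ x) (hv1 : -1 ≤ v) (hv0 : v ≤ 0) (n : ℕ) :
    Integrable fun u : ℝ => dfacC (u + v * I) ^ n * cexp (phase L₂ t₀ x (u + v * I)) := by
  have hg := (integrable_bound hL n).const_mul (Real.exp (L₂ ^ 2 * v ^ 2 + 2 * π * |t₀|))
  have hc : Continuous fun u : ℝ => dfacC (u + v * I) ^ n * cexp (phase L₂ t₀ x (u + v * I)) := by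
    unfold dfacC phase; fun_prop
  refine hg.mono' hc.aestronglyMeasurable (Eventually.of_forall fun u => ?_)
  rw [norm_mul, norm_pow, Complex.norm_exp]
  have h1 := norm_dfacC_le u v
  have h2 := re_phase_le_of_neg_one_le (L₂ := L₂) (t₀ := t₀) (u := u) hx hv1 hv0
  have h3 : Real.exp ((phase L₂ t₀ x (u + v * I)).re)
      ≤ Real.exp (L₂ ^ 2 * v ^ 2 + 2 * π * |t₀|) * Real.exp (u / 2 - L₂ ^ 2 * u ^ 2) := by
    rw [← Real.exp_add]; exact Real.exp_le_exp.mpr (by linarith)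
  calc ‖dfacC (u + v * I)‖ ^ n * Real.exp ((phase L₂ t₀ x (u + v * I)).re)
      ≤ (2 * π * (Real.exp u + 1)) ^ n
        * (Real.exp (L₂ ^ 2 * v ^ 2 + 2 * π * |t₀|) * Real.exp (u / 2 - L₂ ^ 2 * u ^ 2)) := by
        gcongr
    _ = Real.exp (L₂ ^ 2 * v ^ 2 + 2 * π * |t₀|)
        * ((2 * π * (Real.exp u + 1)) ^ n * Real.exp (u / 2 - L₂ ^ 2 * u ^ 2)) := by ring

/-- `cR − L₂²R² → −∞` (`L₂ ≥ 1`, any `c`). [folklore] -/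
private lemma tendsto_lin_sub_sq {L₂ : ℝ} (hL : 1 ≤ L₂) (c : ℝ) :
    Tendsto (fun R : ℝ => c * R - L₂ ^ 2 * R ^ 2) atTop atBot := by
  rw [tendsto_atTop_atBot]
  intro b
  refine ⟨max 1 (|c| + |b| + 1), fun R hR => ?_⟩
  have hR1 : 1 ≤ R := (le_max_left _ _).trans hR
  have hR2 : |c| + |b| + 1 ≤ R := (le_max_right _ _).trans hR
  have hL2 : 1 ≤ L₂ ^ 2 := one_le_pow₀ hL
  have h1 : R ^ 2 ≤ L₂ ^ 2 * R ^ 2 := by nlinarith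
  have h2 : c * R ≤ |c| * R := by nlinarith [le_abs_self c]
  nlinarith [neg_abs_le b, abs_nonneg b, abs_nonneg c]

/-- The side at `Re w = R` vanishes for the order-`n` integrand (`L₂ ≥ 1`, `x ≥ 0`).
[cite: Zhang2022LandauSiegel, §5 (5.12), Lemma 5.4 (proof)] -/
theorem tendsto_integral_far_side_pow {L₂ : ℝ} (hL : 1 ≤ L₂) (t₀ : ℝ) {x : ℝ} (hx : 0 ≤ x) (n : ℕ) :
    Tendsto (fun R : ℝ => I * ∫ y in (-(1 / L₂))..0,
        dfacC (R + y * I) ^ n * cexp (phase L₂ t₀ x (R + y * I))) atTop (𝓝 0) := by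
  have hL0 : 0 < L₂ := by linarith
  set C : ℝ := Real.exp (1 + 2 * π * |t₀|) * (1 / L₂) * (2 * π) ^ n * 2 ^ n with hC
  -- majorant: `C (e^{(n+1/2)R − L₂²R²} + e^{R/2 − L₂²R²})`
  refine squeeze_zero_norm (a := fun R => C * (Real.exp (((n : ℝ) + 1 / 2) * R - L₂ ^ 2 * R ^ 2)
      + Real.exp (1 / 2 * R - L₂ ^ 2 * R ^ 2))) (fun R => ?_) ?_
  · have hpt : ∀ y ∈ Set.uIoc (-(1 / L₂)) (0 : ℝ),
        ‖dfacC (R + y * I) ^ n * cexp (phase L₂ t₀ x (R + y * I))‖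
          ≤ (2 * π * (Real.exp R + 1)) ^ n
            * (Real.exp (1 + 2 * π * |t₀|) * Real.exp (R / 2 - L₂ ^ 2 * R ^ 2)) := by
      intro y hy
      rw [Set.uIoc_of_le (by rw [neg_nonpos]; positivity)] at hy
      have hy1 : -1 ≤ y := by
        have : 1 / L₂ ≤ 1 := (div_le_one hL0).mpr hL
        linarith [hy.1]
      have hy0 : y ≤ 0 := hy.2
      have hyL : L₂ ^ 2 * y ^ 2 ≤ 1 := by
        have h1 : |y| ≤ 1 / L₂ := by rw [abs_of_nonpos hy0]; linarith [hy.1]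
        have h2 : |y| * L₂ ≤ 1 := by
          have := mul_le_mul_of_nonneg_right h1 hL0.le
          rwa [one_div, inv_mul_cancel₀ hL0.ne'] at this
        have h0 : 0 ≤ |y| * L₂ := by positivity
        calc L₂ ^ 2 * y ^ 2 = (|y| * L₂) ^ 2 := by rw [mul_pow, sq_abs]; ring
          _ ≤ 1 := pow_le_one₀ h0 h2
      rw [norm_mul, norm_pow, Complex.norm_exp]
      have h1 := norm_dfacC_le R y
      have h2 := re_phase_le_of_neg_one_le (L₂ := L₂) (t₀ := t₀) (u := R) hx hy1 hy0
      have h3 : Real.exp ((phase L₂ t₀ x (R + y * I)).re)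
          ≤ Real.exp (1 + 2 * π * |t₀|) * Real.exp (R / 2 - L₂ ^ 2 * R ^ 2) := by
        rw [← Real.exp_add]; exact Real.exp_le_exp.mpr (by linarith)
      gcongr
    rw [norm_mul, Complex.norm_I, one_mul]
    have hpow := exp_add_one_pow_le R n
    calc ‖∫ y in (-(1 / L₂))..0, dfacC (R + y * I) ^ n * cexp (phase L₂ t₀ x (R + y * I))‖
        ≤ (2 * π * (Real.exp R + 1)) ^ n
            * (Real.exp (1 + 2 * π * |t₀|) * Real.exp (R / 2 - L₂ ^ 2 * R ^ 2)) * |0 - -(1 / L₂)| :=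
          intervalIntegral.norm_integral_le_of_norm_le_const hpt
      _ = Real.exp (1 + 2 * π * |t₀|) * (1 / L₂) * (2 * π) ^ n
            * ((Real.exp R + 1) ^ n * Real.exp (R / 2 - L₂ ^ 2 * R ^ 2)) := by
          rw [sub_neg_eq_add, zero_add, abs_of_pos (one_div_pos.mpr hL0), mul_pow]; ring
      _ ≤ Real.exp (1 + 2 * π * |t₀|) * (1 / L₂) * (2 * π) ^ n
            * (2 ^ n * (Real.exp (n * R) + 1) * Real.exp (R / 2 - L₂ ^ 2 * R ^ 2)) := by
          gcongr
      _ = C * (Real.exp (((n : ℝ) + 1 / 2) * R - L₂ ^ 2 * R ^ 2)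
            + Real.exp (1 / 2 * R - L₂ ^ 2 * R ^ 2)) := by
          have e1 : Real.exp (((n : ℝ) + 1 / 2) * R - L₂ ^ 2 * R ^ 2)
              = Real.exp (n * R) * Real.exp (R / 2 - L₂ ^ 2 * R ^ 2) := by
            rw [← Real.exp_add]; congr 1; ring
          have e2 : Real.exp (1 / 2 * R - L₂ ^ 2 * R ^ 2) = Real.exp (R / 2 - L₂ ^ 2 * R ^ 2) := by
            congr 1; ring
          rw [e1, e2, hC]; ring
  · have h1 := Real.tendsto_exp_atBot.comp (tendsto_lin_sub_sq hL ((n : ℝ) + 1 / 2))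
    have h2 := Real.tendsto_exp_atBot.comp (tendsto_lin_sub_sq hL (1 / 2))
    have h := (h1.add h2).const_mul C
    rw [add_zero, mul_zero] at h
    exact h

/-! ## "By Cauchy's theorem" for `Δ^{(n)}` -/

/-- **The contour `L′₁ ∪ L′₂ ∪ L′₃` for `Δ^{(n)}`**: for `L₂ ≥ 1`, `x ≥ 0`, any real `a`,
`Δ^{(n)}(x) = ∫_{u ≤ a} fₙ(u) du + ∫_{u > a} fₙ(u − i/L₂) du − i∫_{−1/L₂}^{0} fₙ(a + iy) dy`,
`fₙ(w) = (−2πi(e^w−1))ⁿ e^{phase(w)}`. [cite: Zhang2022LandauSiegel, §5 (5.12), Lemma 5.4 (i) (proof)] -/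
theorem phaseInt_eq_contour {L₂ : ℝ} (hL : 1 ≤ L₂) (t₀ : ℝ) {x : ℝ} (hx : 0 ≤ x) (n : ℕ) (a : ℝ) :
    phaseInt n L₂ t₀ x
      = (∫ u in Iic a, dfac u ^ n * cexp (phase L₂ t₀ x u))
        + (∫ u in Ioi a, dfacC (u + (-(1 / L₂) : ℝ) * I) ^ n
            * cexp (phase L₂ t₀ x (u + (-(1 / L₂) : ℝ) * I)))
        - I * ∫ y in (-(1 / L₂))..0, dfacC (a + y * I) ^ n * cexp (phase L₂ t₀ x (a + y * I)) := by
  have hL0 : 0 < L₂ := by linarith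
  have hL1 : 1 / L₂ ≤ 1 := (div_le_one hL0).mpr hL
  set f : ℂ → ℂ := fun w => dfacC w ^ n * cexp (phase L₂ t₀ x w) with hf
  have hdiff : Differentiable ℂ f := differentiable_integrand L₂ t₀ x n
  have hint : Integrable fun u : ℝ => f u := by
    simp only [hf, dfacC_ofReal]; exact integrable_dfac_pow_mul_cexp_phase hL0.ne' n t₀ x
  have hint' : Integrable fun u : ℝ => f (u + (-(1 / L₂) : ℝ) * I) :=
    integrable_dfacC_pow_mul_cexp_phase_shift hL0.ne' t₀ hx (by linarith)
      (by rw [neg_nonpos]; positivity) n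
  have hrect : ∀ R : ℝ,
      (∫ u in a..R, f u) = (∫ u in a..R, f (u + (-(1 / L₂) : ℝ) * I))
        + I * (∫ y in (-(1 / L₂))..0, f (R + y * I))
        - I * (∫ y in (-(1 / L₂))..0, f (a + y * I)) := by
    intro R
    have h := Complex.integral_boundary_rect_eq_zero_of_differentiableOn f
      ((a : ℂ) + ((-(1 / L₂) : ℝ) : ℂ) * I) (R : ℂ) hdiff.differentiableOn
    simp only [Complex.add_re, Complex.add_im, Complex.ofReal_re, Complex.ofReal_im,
      Complex.mul_re, Complex.mul_im, Complex.I_re, Complex.I_im, mul_zero, mul_one, sub_zero,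
      zero_add, add_zero, Complex.ofReal_zero, zero_mul, smul_eq_mul] at h
    linear_combination -h
  have T1 : Tendsto (fun R : ℝ => ∫ u in a..R, f u) atTop (𝓝 (∫ u in Ioi a, f u)) :=
    intervalIntegral_tendsto_integral_Ioi a hint.integrableOn tendsto_id
  have T2 : Tendsto (fun R : ℝ => ∫ u in a..R, f (u + (-(1 / L₂) : ℝ) * I)) atTop
      (𝓝 (∫ u in Ioi a, f (u + (-(1 / L₂) : ℝ) * I))) :=
    intervalIntegral_tendsto_integral_Ioi a hint'.integrableOn tendsto_id
  have T3 : Tendsto (fun R : ℝ => I * ∫ y in (-(1 / L₂))..0, f (R + y * I)) atTop (𝓝 0) :=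
    tendsto_integral_far_side_pow hL t₀ hx n
  have T : Tendsto (fun R : ℝ => ∫ u in a..R, f u) atTop
      (𝓝 ((∫ u in Ioi a, f (u + (-(1 / L₂) : ℝ) * I)) + 0
        - I * (∫ y in (-(1 / L₂))..0, f (a + y * I)))) := by
    have := (T2.add T3).sub (tendsto_const_nhds
      (x := I * (∫ y in (-(1 / L₂))..0, f (a + y * I))))
    refine this.congr fun R => ?_
    rw [hrect R]
  have hlim := tendsto_nhds_unique T1 T
  rw [add_zero] at hlim
  rw [phaseInt_def]
  have e0 : (fun u : ℝ => dfac u ^ n * cexp (phase L₂ t₀ x u)) = fun u : ℝ => f u := by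
    funext u; simp only [hf, dfacC_ofReal]
  rw [e0, ← intervalIntegral.integral_Iic_add_Ioi (hint.integrableOn (s := Iic a))
    (hint.integrableOn (s := Ioi a)), hlim]
  simp only [hf, dfacC_ofReal]
  ring

/-! ## The analogue of (5.9) for `Δ^{(n)}` -/

/-- The constant `Jₙ = ∫_ℝ (2π(e^u+1))ⁿ e^{u/2 − L₂²u²} du` (finite by `integrable_bound`).
[cite: Zhang2022LandauSiegel, §5 Lemma 5.4 (i) (proof)] -/
def Jconst (L₂ : ℝ) (n : ℕ) : ℝ := ∫ u : ℝ, (2 * π * (Real.exp u + 1)) ^ n * Real.exp (u / 2 - L₂ ^ 2 * u ^ 2)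

/-- `Jₙ ≥ 0`. [folklore] -/
private lemma Jconst_nonneg (L₂ : ℝ) (n : ℕ) : 0 ≤ Jconst L₂ n :=
  integral_nonneg fun u => by positivity

/-- **The trivial bound** `‖Δ^{(n)}(x)‖ ≤ Jₙ` for all real `x` (`L₂ ≠ 0`).
[cite: Zhang2022LandauSiegel, §5 Lemma 5.4 (i) (proof)] -/
theorem norm_phaseInt_le {L₂ : ℝ} (hL : L₂ ≠ 0) (t₀ x : ℝ) (n : ℕ) :
    ‖phaseInt n L₂ t₀ x‖ ≤ Jconst L₂ n := by
  rw [phaseInt_def, Jconst]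
  calc ‖∫ u : ℝ, dfac u ^ n * cexp (phase L₂ t₀ x u)‖
      ≤ ∫ u : ℝ, ‖dfac u ^ n * cexp (phase L₂ t₀ x u)‖ := norm_integral_le_integral_norm _
    _ ≤ ∫ u : ℝ, (2 * π * (Real.exp u + 1)) ^ n * Real.exp (u / 2 - L₂ ^ 2 * u ^ 2) :=
        integral_mono (integrable_dfac_pow_mul_cexp_phase hL n t₀ x).norm (integrable_bound hL n)
          fun u => norm_dfac_pow_mul_cexp_phase_le L₂ t₀ x u n

/-- **(5.12), `j = 1`, for `Δ^{(n)}`**: `‖∫_{u ≤ a} fₙ‖ ≤ 2(4π)ⁿ e^{−(cL₂ log x)²}` (`a = −c log x ≤ 0`).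
[cite: Zhang2022LandauSiegel, §5 (5.12), Lemma 5.4 (i) (proof)] -/
theorem norm_integral_L1'_pow_le {L₂ : ℝ} (hL : L₂ ≠ 0) (t₀ x : ℝ) {c : ℝ} (hc : 0 ≤ c * Real.log x)
    (n : ℕ) :
    ‖∫ u in Iic (-(c * Real.log x)), dfac u ^ n * cexp (phase L₂ t₀ x u)‖
      ≤ 2 * (4 * π) ^ n * Real.exp (-(c * L₂ * Real.log x) ^ 2) := by
  set a : ℝ := -(c * Real.log x) with ha
  set K : ℝ := (c * L₂ * Real.log x) ^ 2 with hK
  have ha0 : a ≤ 0 := by rw [ha]; linarith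
  have hpt : ∀ u ∈ Iic a, ‖dfac u ^ n * cexp (phase L₂ t₀ x u)‖
      ≤ (4 * π) ^ n * Real.exp (-K) * Real.exp (1 / 2 * u) := by
    intro u hu
    have hu0 : u ≤ 0 := le_trans hu ha0
    rw [norm_mul, norm_pow, Complex.norm_exp]
    have h1 : ‖dfac u‖ ≤ 4 * π := by
      rw [← dfacC_ofReal, show ((u : ℝ) : ℂ) = (u : ℂ) + (0 : ℝ) * I by simp]
      exact (norm_dfacC_le u 0).trans (two_pi_mul_exp_add_one_le hu0)
    have h2 : Real.exp ((phase L₂ t₀ x u).re) ≤ Real.exp (-K) * Real.exp (1 / 2 * u) := by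
      rw [← Real.exp_add]
      apply Real.exp_le_exp.mpr
      have := re_phase_le_L1' L₂ t₀ x hc hu
      rw [← hK] at this
      linarith
    calc ‖dfac u‖ ^ n * Real.exp ((phase L₂ t₀ x u).re)
        ≤ (4 * π) ^ n * (Real.exp (-K) * Real.exp (1 / 2 * u)) := by gcongr
      _ = (4 * π) ^ n * Real.exp (-K) * Real.exp (1 / 2 * u) := by ring
  have hint : IntegrableOn (fun u : ℝ => (4 * π) ^ n * Real.exp (-K) * Real.exp (1 / 2 * u)) (Iic a) :=
    (integrableOn_exp_mul_Iic (by norm_num : (0 : ℝ) < 1 / 2) a).const_mul _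
  calc ‖∫ u in Iic a, dfac u ^ n * cexp (phase L₂ t₀ x u)‖
      ≤ ∫ u in Iic a, ‖dfac u ^ n * cexp (phase L₂ t₀ x u)‖ := norm_integral_le_integral_norm _
    _ ≤ ∫ u in Iic a, (4 * π) ^ n * Real.exp (-K) * Real.exp (1 / 2 * u) :=
        setIntegral_mono_on (integrable_dfac_pow_mul_cexp_phase hL n t₀ x).norm.integrableOn hint
          measurableSet_Iic hpt
    _ = (4 * π) ^ n * Real.exp (-K) * (Real.exp (1 / 2 * a) / (1 / 2)) := by
        rw [MeasureTheory.integral_const_mul, integral_exp_mul_Iic (by norm_num)]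
    _ ≤ 2 * (4 * π) ^ n * Real.exp (-K) := by
        have : Real.exp (1 / 2 * a) ≤ 1 := by rw [Real.exp_le_one_iff]; linarith
        have h0 : 0 < (4 * π) ^ n * Real.exp (-K) := by positivity
        nlinarith

/-- **(5.12), `j = 2`, for `Δ^{(n)}`**: `‖i∫_{−1/L₂}^0 fₙ(a+iy) dy‖ ≤ (4π)ⁿ e^{1−(cL₂ log x)²}/L₂`.
[cite: Zhang2022LandauSiegel, §5 (5.12), Lemma 5.4 (i) (proof)] -/
theorem norm_integral_L2'_pow_le {L₂ : ℝ} (hL : 1 ≤ L₂) (t₀ x : ℝ) {c X : ℝ} (hc : 0 ≤ c * Real.log x)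
    (hX : 0 < X) (hXle : X ≤ x * Real.exp (-(c * Real.log x))) (ht : 2 * t₀ < X) (n : ℕ) :
    ‖I * ∫ y in (-(1 / L₂))..0, dfacC ((-(c * Real.log x) : ℝ) + y * I) ^ n
        * cexp (phase L₂ t₀ x ((-(c * Real.log x) : ℝ) + y * I))‖
      ≤ (4 * π) ^ n * Real.exp (1 - (c * L₂ * Real.log x) ^ 2) / L₂ := by
  have hL0 : 0 < L₂ := by linarith
  have ha0 : -(c * Real.log x) ≤ 0 := by linarith
  have hpt : ∀ y ∈ Set.uIoc (-(1 / L₂)) (0 : ℝ),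
      ‖dfacC ((-(c * Real.log x) : ℝ) + y * I) ^ n
          * cexp (phase L₂ t₀ x ((-(c * Real.log x) : ℝ) + y * I))‖
        ≤ (4 * π) ^ n * Real.exp (1 - (c * L₂ * Real.log x) ^ 2) := by
    intro y hy
    rw [Set.uIoc_of_le (by rw [neg_nonpos]; positivity)] at hy
    rw [norm_mul, norm_pow, Complex.norm_exp]
    have h1 : ‖dfacC ((-(c * Real.log x) : ℝ) + y * I)‖ ≤ 4 * π :=
      (norm_dfacC_le _ y).trans (two_pi_mul_exp_add_one_le ha0)
    have h2 : Real.exp ((phase L₂ t₀ x ((-(c * Real.log x) : ℝ) + y * I)).re)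
        ≤ Real.exp (1 - (c * L₂ * Real.log x) ^ 2) := by
      apply Real.exp_le_exp.mpr
      have := re_phase_le_L2' hL t₀ x hc hy.1.le hy.2 hX hXle ht
      linarith
    gcongr
  rw [norm_mul, Complex.norm_I, one_mul]
  calc ‖∫ y in (-(1 / L₂))..0, dfacC ((-(c * Real.log x) : ℝ) + y * I) ^ n
          * cexp (phase L₂ t₀ x ((-(c * Real.log x) : ℝ) + y * I))‖
      ≤ (4 * π) ^ n * Real.exp (1 - (c * L₂ * Real.log x) ^ 2) * |0 - -(1 / L₂)| :=
        intervalIntegral.norm_integral_le_of_norm_le_const hpt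
    _ = (4 * π) ^ n * Real.exp (1 - (c * L₂ * Real.log x) ^ 2) / L₂ := by
        rw [sub_neg_eq_add, zero_add, abs_of_pos (one_div_pos.mpr hL0)]; ring

/-- **(5.12), `j = 3`, for `Δ^{(n)}`**: `‖∫_{u > a} fₙ(u − i/L₂) du‖ ≤ e·Jₙ·e^{−X/L₂}`
(`L₂ ≥ 1`, `x ≥ 0`, `0 < X ≤ xe^{a}`, `2t₀ < X`). [cite: Zhang2022LandauSiegel, §5 (5.12), Lemma 5.4 (i) (proof)] -/
theorem norm_integral_L3'_pow_le {L₂ : ℝ} (hL : 1 ≤ L₂) (t₀ : ℝ) {x a X : ℝ} (hx : 0 ≤ x)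
    (hX : 0 < X) (hXle : X ≤ x * Real.exp a) (ht : 2 * t₀ < X) (n : ℕ) :
    ‖∫ u in Ioi a, dfacC (u + (-(1 / L₂) : ℝ) * I) ^ n * cexp (phase L₂ t₀ x (u + (-(1 / L₂) : ℝ) * I))‖
      ≤ Real.exp 1 * Jconst L₂ n * Real.exp (-(X / L₂)) := by
  have hL0 : 0 < L₂ := by linarith
  set C : ℝ := Real.exp (1 - X / L₂) with hC
  have hpt : ∀ u ∈ Ioi a,
      ‖dfacC (u + (-(1 / L₂) : ℝ) * I) ^ n * cexp (phase L₂ t₀ x (u + (-(1 / L₂) : ℝ) * I))‖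
        ≤ C * ((2 * π * (Real.exp u + 1)) ^ n * Real.exp (u / 2 - L₂ ^ 2 * u ^ 2)) := by
    intro u hu
    have hu' : a < u := hu
    have hXu : X ≤ x * Real.exp u :=
      hXle.trans (mul_le_mul_of_nonneg_left (Real.exp_le_exp.mpr hu'.le) hx)
    rw [norm_mul, norm_pow, Complex.norm_exp]
    have h1 := norm_dfacC_le u (-(1 / L₂))
    have h2 : Real.exp ((phase L₂ t₀ x (u + (-(1 / L₂) : ℝ) * I)).re)
        ≤ C * Real.exp (u / 2 - L₂ ^ 2 * u ^ 2) := by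
      rw [hC, ← Real.exp_add]
      apply Real.exp_le_exp.mpr
      have := re_phase_lt_L3' hL t₀ x u hX hXu ht
      have e1 : (L₂ * u) ^ 2 = L₂ ^ 2 * u ^ 2 := by ring
      linarith
    calc ‖dfacC (u + (-(1 / L₂) : ℝ) * I)‖ ^ n * Real.exp ((phase L₂ t₀ x (u + (-(1 / L₂) : ℝ) * I)).re)
        ≤ (2 * π * (Real.exp u + 1)) ^ n * (C * Real.exp (u / 2 - L₂ ^ 2 * u ^ 2)) := by gcongr
      _ = C * ((2 * π * (Real.exp u + 1)) ^ n * Real.exp (u / 2 - L₂ ^ 2 * u ^ 2)) := by ring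
  have hgi := integrable_bound hL0.ne' n
  have hint' := integrable_dfacC_pow_mul_cexp_phase_shift hL0.ne' t₀ hx (v := -(1 / L₂))
    (by have := (div_le_one hL0).mpr hL; linarith) (by rw [neg_nonpos]; positivity) n
  calc ‖∫ u in Ioi a, dfacC (u + (-(1 / L₂) : ℝ) * I) ^ n * cexp (phase L₂ t₀ x (u + (-(1 / L₂) : ℝ) * I))‖
      ≤ ∫ u in Ioi a, ‖dfacC (u + (-(1 / L₂) : ℝ) * I) ^ n
          * cexp (phase L₂ t₀ x (u + (-(1 / L₂) : ℝ) * I))‖ := norm_integral_le_integral_norm _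
    _ ≤ ∫ u in Ioi a, C * ((2 * π * (Real.exp u + 1)) ^ n * Real.exp (u / 2 - L₂ ^ 2 * u ^ 2)) :=
        setIntegral_mono_on hint'.norm.integrableOn (hgi.const_mul C).integrableOn
          measurableSet_Ioi hpt
    _ ≤ ∫ u : ℝ, C * ((2 * π * (Real.exp u + 1)) ^ n * Real.exp (u / 2 - L₂ ^ 2 * u ^ 2)) :=
        setIntegral_le_integral (hgi.const_mul C) (Eventually.of_forall fun u => by positivity)
    _ = Real.exp 1 * Jconst L₂ n * Real.exp (-(X / L₂)) := by
        rw [MeasureTheory.integral_const_mul, hC, show (1 : ℝ) - X / L₂ = 1 + -(X / L₂) by ring,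
          Real.exp_add, Jconst]
        ring

/-- **The analogue of (5.9) for `Δ^{(n)}`**: for `L₂ ≥ 1`, `x ≥ 0`, `c·log x ≥ 0`,
`0 < X ≤ x e^{−c log x}`, `2t₀ < X`:
`‖Δ^{(n)}(x)‖ ≤ 2(4π)ⁿe^{−(cL₂ log x)²} + (4π)ⁿe^{1−(cL₂ log x)²}/L₂ + e·Jₙ·e^{−X/L₂}`.
[cite: Zhang2022LandauSiegel, §5 Lemma 5.3 (5.9), Lemma 5.4 (i) (proof)] -/
theorem norm_phaseInt_le_caseTwo {L₂ : ℝ} (hL : 1 ≤ L₂) (t₀ : ℝ) {x c X : ℝ} (hx : 0 ≤ x)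
    (hc : 0 ≤ c * Real.log x) (hX : 0 < X) (hXle : X ≤ x * Real.exp (-(c * Real.log x)))
    (ht : 2 * t₀ < X) (n : ℕ) :
    ‖phaseInt n L₂ t₀ x‖
      ≤ 2 * (4 * π) ^ n * Real.exp (-(c * L₂ * Real.log x) ^ 2)
        + (4 * π) ^ n * Real.exp (1 - (c * L₂ * Real.log x) ^ 2) / L₂
        + Real.exp 1 * Jconst L₂ n * Real.exp (-(X / L₂)) := by
  have hL0 : 0 < L₂ := by linarith
  rw [phaseInt_eq_contour hL t₀ hx n (-(c * Real.log x))]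
  have h1 := norm_integral_L1'_pow_le hL0.ne' t₀ x hc n
  have h2 := norm_integral_L2'_pow_le hL t₀ x hc hX hXle ht n
  have h3 := norm_integral_L3'_pow_le hL t₀ hx hX hXle ht n
  calc ‖(∫ u in Iic (-(c * Real.log x)), dfac u ^ n * cexp (phase L₂ t₀ x u))
        + (∫ u in Ioi (-(c * Real.log x)), dfacC (u + (-(1 / L₂) : ℝ) * I) ^ n
            * cexp (phase L₂ t₀ x (u + (-(1 / L₂) : ℝ) * I)))
        - I * ∫ y in (-(1 / L₂))..0, dfacC ((-(c * Real.log x) : ℝ) + y * I) ^ n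
            * cexp (phase L₂ t₀ x ((-(c * Real.log x) : ℝ) + y * I))‖
      ≤ ‖∫ u in Iic (-(c * Real.log x)), dfac u ^ n * cexp (phase L₂ t₀ x u)‖
        + ‖∫ u in Ioi (-(c * Real.log x)), dfacC (u + (-(1 / L₂) : ℝ) * I) ^ n
            * cexp (phase L₂ t₀ x (u + (-(1 / L₂) : ℝ) * I))‖
        + ‖I * ∫ y in (-(1 / L₂))..0, dfacC ((-(c * Real.log x) : ℝ) + y * I) ^ n
            * cexp (phase L₂ t₀ x ((-(c * Real.log x) : ℝ) + y * I))‖ :=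
        (norm_sub_le _ _).trans (add_le_add (norm_add_le _ _) le_rfl)
    _ ≤ 2 * (4 * π) ^ n * Real.exp (-(c * L₂ * Real.log x) ^ 2)
        + Real.exp 1 * Jconst L₂ n * Real.exp (-(X / L₂))
        + (4 * π) ^ n * Real.exp (1 - (c * L₂ * Real.log x) ^ 2) / L₂ :=
        add_le_add (add_le_add h1 h3) h2
    _ = _ := by ring

/-! ## Super-polynomial decay of `Δ^{(n)}(x)` as `x → ∞` -/

/-- `Δ^{(n)}` is continuous (indeed differentiable, `hasDerivAt_phaseInt`).
[cite: Zhang2022LandauSiegel, §5 Lemma 5.4 (i) (proof)] -/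
theorem continuous_phaseInt {L₂ : ℝ} (hL : L₂ ≠ 0) (n : ℕ) (t₀ : ℝ) :
    Continuous fun x : ℝ => phaseInt n L₂ t₀ x :=
  continuous_iff_continuousAt.mpr fun x => (hasDerivAt_phaseInt hL n t₀ x).continuousAt

/-- `e^{−(log x)²/4} ≤ e^{k²}·x^{−k}` for `x > 0` (AM–GM in the exponent). [folklore] -/
private lemma exp_neg_log_sq_le {x : ℝ} (hx : 0 < x) (k : ℝ) :
    Real.exp (-((Real.log x) ^ 2 / 4)) ≤ Real.exp (k ^ 2) * x ^ (-k) := by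
  rw [Real.rpow_def_of_pos hx, ← Real.exp_add]
  apply Real.exp_le_exp.mpr
  nlinarith [sq_nonneg (Real.log x / 2 - k)]

/-- `e^{−y} ≤ n!·y^{−n}` for `y > 0`. [folklore] -/
private lemma exp_neg_le_factorial_mul {y : ℝ} (hy : 0 < y) (n : ℕ) :
    Real.exp (-y) ≤ (n.factorial : ℝ) * y ^ (-(n : ℝ)) := by
  have h := Real.pow_div_factorial_le_exp y hy.le n
  have hfac : (0 : ℝ) < n.factorial := by exact_mod_cast Nat.factorial_pos n
  rw [div_le_iff₀ hfac] at h
  rw [Real.rpow_neg hy.le, Real.rpow_natCast, Real.exp_neg]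
  have hyn : 0 < y ^ n := pow_pos hy n
  rw [inv_le_iff_one_le_mul₀ (Real.exp_pos y)]
  calc (1 : ℝ) = y ^ n * (y ^ n)⁻¹ := by field_simp
    _ ≤ (Real.exp y * n.factorial) * (y ^ n)⁻¹ := by gcongr
    _ = n.factorial * (y ^ n)⁻¹ * Real.exp y := by ring

/-- **Super-polynomial decay of `Δ^{(n)}`** ("upper bounds for `Δ″(x)` analogous to Lemma 5.3"):
for `L₂ ≥ 1`, every `k : ℕ` admits `C` with `‖Δ^{(n)}(x)‖ ≤ C·x^{−k}` for all `x ≥ 1` (the analogue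
of (5.9) with `c = 1/2`, `X = √x`, and the trivial bound while `√x ≤ 2t₀`).
[cite: Zhang2022LandauSiegel, §5 Lemma 5.4 (i) (proof), Lemma 5.3 (5.9)] -/
theorem exists_norm_phaseInt_le_rpow_neg {L₂ : ℝ} (hL : 1 ≤ L₂) (t₀ : ℝ) (n k : ℕ) :
    ∃ C : ℝ, 0 ≤ C ∧ ∀ x : ℝ, 1 ≤ x → ‖phaseInt n L₂ t₀ x‖ ≤ C * x ^ (-(k : ℝ)) := by
  have hL0 : 0 < L₂ := by linarith
  -- constants
  set M : ℝ := Jconst L₂ n with hM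
  have hM0 : 0 ≤ M := Jconst_nonneg L₂ n
  set x₀ : ℝ := max 1 (4 * t₀ ^ 2 + 1) with hx₀
  have hx₀1 : 1 ≤ x₀ := le_max_left _ _
  set C₁ : ℝ := (2 + Real.exp 1 / L₂) * (4 * π) ^ n * Real.exp ((k : ℝ) ^ 2) with hC₁
  set C₂ : ℝ := Real.exp 1 * M * (((2 * k).factorial : ℝ) * L₂ ^ (2 * k)) with hC₂
  set C₃ : ℝ := M * x₀ ^ (k : ℝ) with hC₃
  refine ⟨C₁ + C₂ + C₃, by positivity, fun x hx1 => ?_⟩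
  have hx0 : 0 < x := by linarith
  have hxk : 0 < x ^ (-(k : ℝ)) := Real.rpow_pos_of_pos hx0 _
  by_cases hxx : x₀ < x
  · -- the decay range: the analogue of (5.9) with `c = 1/2`, `X = √x`
    have hsx : 0 < Real.sqrt x := Real.sqrt_pos.mpr hx0
    have ht : 2 * t₀ < Real.sqrt x := by
      have h4 : 4 * t₀ ^ 2 + 1 ≤ x₀ := le_max_right _ _
      have : 4 * t₀ ^ 2 < x := by linarith
      calc 2 * t₀ ≤ |2 * t₀| := le_abs_self _
        _ = Real.sqrt ((2 * t₀) ^ 2) := (Real.sqrt_sq_eq_abs _).symm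
        _ < Real.sqrt x := Real.sqrt_lt_sqrt (sq_nonneg _) (by nlinarith)
    have hc : 0 ≤ 1 / 2 * Real.log x := by
      have := Real.log_nonneg hx1; positivity
    have hX : Real.sqrt x ≤ x * Real.exp (-(1 / 2 * Real.log x)) := by
      have e1 : Real.exp (-(1 / 2 * Real.log x)) = x ^ (-(1 / 2 : ℝ)) := by
        rw [Real.rpow_def_of_pos hx0]; congr 1; ring
      rw [e1, Real.sqrt_eq_rpow,
        show x * x ^ (-(1 / 2 : ℝ)) = x ^ (1 : ℝ) * x ^ (-(1 / 2 : ℝ)) by rw [Real.rpow_one],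
        ← Real.rpow_add hx0]
      norm_num
    have hmain := norm_phaseInt_le_caseTwo hL t₀ hx0.le hc hsx hX ht n
    -- the Gaussian-in-log terms
    have hlog : Real.exp (-(1 / 2 * L₂ * Real.log x) ^ 2)
        ≤ Real.exp ((k : ℝ) ^ 2) * x ^ (-(k : ℝ)) := by
      have h1 : Real.exp (-(1 / 2 * L₂ * Real.log x) ^ 2) ≤ Real.exp (-((Real.log x) ^ 2 / 4)) := by
        apply Real.exp_le_exp.mpr
        have hL2 : 1 ≤ L₂ ^ 2 := one_le_pow₀ hL
        nlinarith [sq_nonneg (Real.log x), mul_le_mul_of_nonneg_right hL2 (sq_nonneg (Real.log x))]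
      exact h1.trans (exp_neg_log_sq_le hx0 k)
    have hT12 : 2 * (4 * π) ^ n * Real.exp (-(1 / 2 * L₂ * Real.log x) ^ 2)
          + (4 * π) ^ n * Real.exp (1 - (1 / 2 * L₂ * Real.log x) ^ 2) / L₂
        ≤ C₁ * x ^ (-(k : ℝ)) := by
      have e2 : (4 * π) ^ n * Real.exp (1 - (1 / 2 * L₂ * Real.log x) ^ 2) / L₂
          = Real.exp 1 / L₂ * (4 * π) ^ n * Real.exp (-(1 / 2 * L₂ * Real.log x) ^ 2) := by
        rw [sub_eq_add_neg, Real.exp_add]; ring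
      rw [e2, hC₁]
      have hpos : 0 ≤ Real.exp 1 / L₂ * (4 * π) ^ n := by positivity
      have hpos' : 0 ≤ 2 * (4 * π) ^ n := by positivity
      have i1 := mul_le_mul_of_nonneg_left hlog hpos
      have i2 := mul_le_mul_of_nonneg_left hlog hpos'
      nlinarith [i1, i2]
    -- the `e^{−√x/L₂}` term
    have hT3 : Real.exp (-(Real.sqrt x / L₂))
        ≤ ((2 * k).factorial : ℝ) * L₂ ^ (2 * k) * x ^ (-(k : ℝ)) := by
      have h := exp_neg_le_factorial_mul (y := Real.sqrt x / L₂) (by positivity) (2 * k)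
      have e : (Real.sqrt x / L₂) ^ (-((2 * k : ℕ) : ℝ)) = L₂ ^ (2 * k) * x ^ (-(k : ℝ)) := by
        rw [Real.rpow_neg (by positivity), Real.rpow_natCast, div_pow, pow_mul,
          Real.sq_sqrt hx0.le, Real.rpow_neg hx0.le, Real.rpow_natCast]
        field_simp
      rw [e, ← mul_assoc] at h
      exact h
    have hT3' : Real.exp 1 * Jconst L₂ n * Real.exp (-(Real.sqrt x / L₂))
        ≤ C₂ * x ^ (-(k : ℝ)) := by
      rw [hC₂, ← hM, mul_assoc (Real.exp 1 * M)]
      exact mul_le_mul_of_nonneg_left hT3 (by positivity)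
    have h3 : 0 ≤ C₃ * x ^ (-(k : ℝ)) := by positivity
    calc ‖phaseInt n L₂ t₀ x‖ ≤ _ := hmain
      _ ≤ C₁ * x ^ (-(k : ℝ)) + C₂ * x ^ (-(k : ℝ)) := add_le_add hT12 hT3'
      _ ≤ (C₁ + C₂ + C₃) * x ^ (-(k : ℝ)) := by nlinarith
  · -- the compact range `1 ≤ x ≤ x₀`: trivial bound
    have hxx : x ≤ x₀ := not_lt.mp hxx
    have h1 : ‖phaseInt n L₂ t₀ x‖ ≤ M := norm_phaseInt_le hL0.ne' t₀ x n
    have h2 : M ≤ C₃ * x ^ (-(k : ℝ)) := by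
      rw [hC₃, mul_assoc]
      have : 1 ≤ x₀ ^ (k : ℝ) * x ^ (-(k : ℝ)) := by
        rw [Real.rpow_neg hx0.le, ← div_eq_mul_inv, one_le_div (Real.rpow_pos_of_pos hx0 _)]
        exact Real.rpow_le_rpow hx0.le hxx (Nat.cast_nonneg k)
      nlinarith
    have h3 : 0 ≤ (C₁ + C₂) * x ^ (-(k : ℝ)) := by positivity
    nlinarith

/-! ## Integrability of `Δ^{(n)}(x)x^{s−1}` on `(0, ∞)` for `σ > 0` -/

/-- The integrand `x ↦ ‖Δ^{(n)}(x)‖·x^{a−1}` is continuous on `(0, ∞)`. [folklore] -/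
private lemma continuousOn_norm_phaseInt_mul_rpow {L₂ : ℝ} (hL : L₂ ≠ 0) (n : ℕ) (t₀ a : ℝ) :
    ContinuousOn (fun x : ℝ => ‖phaseInt n L₂ t₀ x‖ * x ^ (a - 1)) (Ioi 0) := by
  intro x hx
  have h1 : ContinuousAt (fun x : ℝ => ‖phaseInt n L₂ t₀ x‖) x :=
    ((continuous_phaseInt hL n t₀).continuousAt).norm
  have h2 : ContinuousAt (fun x : ℝ => x ^ (a - 1)) x :=
    Real.continuousAt_rpow_const x (a - 1) (Or.inl (ne_of_gt hx))
  exact (h1.mul h2).continuousWithinAt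

/-- **`∫₀^∞ ‖Δ^{(n)}(x)‖ x^{a−1} dx < ∞` for every `a > 0`** (`L₂ ≥ 1`): near `0` by the trivial
bound, near `∞` by the super-polynomial decay. [cite: Zhang2022LandauSiegel, §5 Lemma 5.4 (i) (proof)] -/
theorem integrableOn_norm_phaseInt_mul_rpow {L₂ : ℝ} (hL : 1 ≤ L₂) (t₀ : ℝ) (n : ℕ) {a : ℝ}
    (ha : 0 < a) :
    IntegrableOn (fun x : ℝ => ‖phaseInt n L₂ t₀ x‖ * x ^ (a - 1)) (Ioi 0) := by
  have hL0 : 0 < L₂ := by linarith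
  set M : ℝ := Jconst L₂ n with hM
  have hcont := continuousOn_norm_phaseInt_mul_rpow hL0.ne' n t₀ a
  rw [← Ioc_union_Ioi_eq_Ioi zero_le_one]
  refine IntegrableOn.union ?_ ?_
  · -- `(0, 1]`
    have hrpow : IntegrableOn (fun x : ℝ => M * x ^ (a - 1)) (Ioc 0 1) := by
      have := intervalIntegral.intervalIntegrable_rpow' (a := 0) (b := 1) (r := a - 1) (by linarith)
      exact ((intervalIntegrable_iff_integrableOn_Ioc_of_le zero_le_one).mp this).const_mul M
    refine hrpow.mono' ((hcont.mono Ioc_subset_Ioi_self).aestronglyMeasurable measurableSet_Ioc) ?_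
    filter_upwards [ae_restrict_mem measurableSet_Ioc] with x hx
    have hxa : 0 ≤ x ^ (a - 1) := Real.rpow_nonneg hx.1.le _
    rw [Real.norm_of_nonneg (mul_nonneg (norm_nonneg _) hxa)]
    exact mul_le_mul_of_nonneg_right (norm_phaseInt_le hL0.ne' t₀ x n) hxa
  · -- `(1, ∞)`
    obtain ⟨C, hC0, hC⟩ := exists_norm_phaseInt_le_rpow_neg hL t₀ n (⌈a⌉₊ + 1)
    set k : ℕ := ⌈a⌉₊ + 1 with hk
    have hk1 : a - 1 + -(k : ℝ) < -1 := by
      have := Nat.le_ceil a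
      rw [hk]; push_cast; linarith
    have hrpow : IntegrableOn (fun x : ℝ => C * x ^ (a - 1 + -(k : ℝ))) (Ioi 1) :=
      (integrableOn_Ioi_rpow_of_lt hk1 zero_lt_one).const_mul C
    refine hrpow.mono' ((hcont.mono (Ioi_subset_Ioi zero_le_one)).aestronglyMeasurable
      measurableSet_Ioi) ?_
    filter_upwards [ae_restrict_mem measurableSet_Ioi] with x hx
    have hx1 : 1 ≤ x := le_of_lt hx
    have hx0 : 0 < x := by linarith
    have hxa : 0 ≤ x ^ (a - 1) := Real.rpow_nonneg hx0.le _
    rw [Real.norm_of_nonneg (mul_nonneg (norm_nonneg _) hxa), Real.rpow_add hx0]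
    calc ‖phaseInt n L₂ t₀ x‖ * x ^ (a - 1) ≤ C * x ^ (-(k : ℝ)) * x ^ (a - 1) :=
          mul_le_mul_of_nonneg_right (hC x hx1) hxa
      _ = C * (x ^ (a - 1) * x ^ (-(k : ℝ))) := by ring

/-- The integrand `Δ^{(n)}(x)x^{s−1}` is continuous on `(0, ∞)` for each `s`. [folklore] -/
private lemma continuousOn_phaseInt_mul_cpow {L₂ : ℝ} (hL : L₂ ≠ 0) (n : ℕ) (t₀ : ℝ) (s : ℂ) :
    ContinuousOn (fun x : ℝ => phaseInt n L₂ t₀ x * (x : ℂ) ^ (s - 1)) (Ioi 0) := by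
  intro x hx
  have h1 : ContinuousAt (fun x : ℝ => phaseInt n L₂ t₀ x) x :=
    (continuous_phaseInt hL n t₀).continuousAt
  have h2 : ContinuousAt (fun x : ℝ => (x : ℂ) ^ (s - 1)) x := by
    have hslit : (x : ℂ) ∈ Complex.slitPlane := by
      rw [Complex.mem_slitPlane_iff]; left; simpa using hx
    exact (continuousAt_cpow_const hslit).comp Complex.continuous_ofReal.continuousAt
  exact (h1.mul h2).continuousWithinAt

/-- **`∫₀^∞ Δ^{(n)}(x)x^{s−1} dx` converges absolutely for `σ > 0`** (`L₂ ≥ 1`).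
[cite: Zhang2022LandauSiegel, §5 Lemma 5.4 (i) (proof), (5.14)] -/
theorem integrableOn_phaseInt_mul_cpow {L₂ : ℝ} (hL : 1 ≤ L₂) (t₀ : ℝ) (n : ℕ) {s : ℂ}
    (hs : 0 < s.re) :
    IntegrableOn (fun x : ℝ => phaseInt n L₂ t₀ x * (x : ℂ) ^ (s - 1)) (Ioi 0) := by
  have hL0 : 0 < L₂ := by linarith
  refine (integrableOn_norm_phaseInt_mul_rpow hL t₀ n hs).mono'
    ((continuousOn_phaseInt_mul_cpow hL0.ne' n t₀ s).aestronglyMeasurable measurableSet_Ioi) ?_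
  filter_upwards [ae_restrict_mem measurableSet_Ioi] with x hx
  rw [norm_mul, Complex.norm_cpow_eq_rpow_re_of_pos hx, sub_re, one_re]

/-! ## "Using partial integration twice" -/

/-- **One partial integration**: for `L₂ ≥ 1`, `σ > 0` and every `n`,
`∫₀^∞ Δ^{(n)}(x)x^{s−1} dx = −(1/s)∫₀^∞ Δ^{(n+1)}(x)x^{s} dx`
(boundary terms vanish: `Δ^{(n)}` is bounded at `0⁺` where `x^s → 0`, and decays faster than any
power at `∞`). [cite: Zhang2022LandauSiegel, §5 Lemma 5.4 (i) (proof)] -/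
theorem integral_phaseInt_mul_cpow_eq {L₂ : ℝ} (hL : 1 ≤ L₂) (t₀ : ℝ) (n : ℕ) {s : ℂ}
    (hs : 0 < s.re) :
    ∫ x in Ioi (0 : ℝ), phaseInt n L₂ t₀ x * (x : ℂ) ^ (s - 1)
      = -(1 / s) * ∫ x in Ioi (0 : ℝ), phaseInt (n + 1) L₂ t₀ x * (x : ℂ) ^ s := by
  have hL0 : 0 < L₂ := by linarith
  have hs0 : s ≠ 0 := fun h => by rw [h, Complex.zero_re] at hs; exact lt_irrefl _ hs
  have hu : ∀ x ∈ Ioi (0 : ℝ),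
      HasDerivAt (fun y : ℝ => phaseInt n L₂ t₀ y) (phaseInt (n + 1) L₂ t₀ x) x :=
    fun x _ => hasDerivAt_phaseInt hL0.ne' n t₀ x
  have hv : ∀ x ∈ Ioi (0 : ℝ),
      HasDerivAt (fun y : ℝ => (y : ℂ) ^ s / s) ((x : ℂ) ^ (s - 1)) x := by
    intro x hx
    have hr : s - 1 ≠ -1 := fun h => hs0 (by linear_combination h)
    have h := hasDerivAt_ofReal_cpow_const' (ne_of_gt hx) hr
    simp only [sub_add_cancel] at h
    exact h
  have huv' : IntegrableOn
      ((fun y : ℝ => phaseInt n L₂ t₀ y) * fun y : ℝ => (y : ℂ) ^ (s - 1)) (Ioi 0) :=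
    integrableOn_phaseInt_mul_cpow hL t₀ n hs
  have hu'v : IntegrableOn
      ((fun y : ℝ => phaseInt (n + 1) L₂ t₀ y) * fun y : ℝ => (y : ℂ) ^ s / s) (Ioi 0) := by
    have h := (integrableOn_phaseInt_mul_cpow hL t₀ (n + 1) (s := s + 1)
      (by rw [Complex.add_re, Complex.one_re]; linarith)).div_const s
    simp only [add_sub_cancel_right] at h
    exact h.congr (Eventually.of_forall fun x => by simp only [Pi.mul_apply]; ring)
  have h_zero : Tendsto ((fun y : ℝ => phaseInt n L₂ t₀ y) * fun y : ℝ => (y : ℂ) ^ s / s)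
      (𝓝[>] 0) (𝓝 0) := by
    have h1 : Tendsto (fun y : ℝ => phaseInt n L₂ t₀ y) (𝓝[>] 0) (𝓝 (phaseInt n L₂ t₀ 0)) :=
      ((continuous_phaseInt hL0.ne' n t₀).tendsto 0).mono_left nhdsWithin_le_nhds
    have h2 : Tendsto (fun y : ℝ => (y : ℂ) ^ s / s) (𝓝[>] 0) (𝓝 0) := by
      refine squeeze_zero_norm' (a := fun y : ℝ => y ^ s.re / ‖s‖) ?_ ?_
      · filter_upwards [self_mem_nhdsWithin] with y hy
        rw [norm_div, Complex.norm_cpow_eq_rpow_re_of_pos hy]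
      · have h3 : Tendsto (fun y : ℝ => y ^ s.re) (𝓝[>] 0) (𝓝 0) := by
          have := (Real.continuousAt_rpow_const 0 s.re (Or.inr hs.le)).tendsto
          rw [Real.zero_rpow (ne_of_gt hs)] at this
          exact this.mono_left nhdsWithin_le_nhds
        simpa using h3.div_const ‖s‖
    have := h1.mul h2
    rw [mul_zero] at this
    exact this
  have h_infty : Tendsto ((fun y : ℝ => phaseInt n L₂ t₀ y) * fun y : ℝ => (y : ℂ) ^ s / s)
      atTop (𝓝 0) := by
    obtain ⟨C, hC0, hC⟩ := exists_norm_phaseInt_le_rpow_neg hL t₀ n (⌈s.re⌉₊ + 1)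
    set k : ℕ := ⌈s.re⌉₊ + 1 with hk
    have hk1 : 0 < (k : ℝ) - s.re := by
      have := Nat.le_ceil s.re
      rw [hk]; push_cast; linarith
    refine squeeze_zero_norm' (a := fun y : ℝ => C / ‖s‖ * y ^ (-((k : ℝ) - s.re))) ?_ ?_
    · filter_upwards [eventually_ge_atTop (1 : ℝ)] with y hy
      have hy0 : 0 < y := by linarith
      rw [Pi.mul_apply, norm_mul, norm_div, Complex.norm_cpow_eq_rpow_re_of_pos hy0]
      calc ‖phaseInt n L₂ t₀ y‖ * (y ^ s.re / ‖s‖) ≤ C * y ^ (-(k : ℝ)) * (y ^ s.re / ‖s‖) := by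
            gcongr; exact hC y hy
        _ = C / ‖s‖ * (y ^ (-(k : ℝ)) * y ^ s.re) := by ring
        _ = C / ‖s‖ * y ^ (-((k : ℝ) - s.re)) := by
            rw [← Real.rpow_add hy0]; congr 1; ring
    · have := (tendsto_rpow_neg_atTop hk1).const_mul (C / ‖s‖)
      rw [mul_zero] at this
      exact this
  have key := integral_Ioi_mul_deriv_eq_deriv_mul hu hv huv' hu'v h_zero h_infty
  rw [key, sub_self, zero_sub, ← MeasureTheory.integral_neg, ← MeasureTheory.integral_const_mul]
  congr 1
  funext x
  ring

/-- **"Using partial integration twice we obtain `δ(s) = (1/(s(s+1)))∫₀^∞ Δ″(x)x^{s+1} dx`"**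
(source prints `ds` for `dx`), for `L₂ ≥ 1` and every `s` with `σ > 0`; `Δ″ = phaseInt 2`
(`deriv_deriv_Delta510`). [cite: Zhang2022LandauSiegel, §5 Lemma 5.4 (i) (proof)] -/
theorem delta514_eq {L₂ : ℝ} (hL : 1 ≤ L₂) (t₀ : ℝ) {s : ℂ} (hs : 0 < s.re) :
    delta514 L₂ t₀ s
      = 1 / (s * (s + 1)) * ∫ x in Ioi (0 : ℝ), phaseInt 2 L₂ t₀ x * (x : ℂ) ^ (s + 1) := by
  have hs0 : s ≠ 0 := fun h => by rw [h, Complex.zero_re] at hs; exact lt_irrefl _ hs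
  have hs1 : s + 1 ≠ 0 := fun h => by
    have := congrArg Complex.re h
    rw [Complex.add_re, Complex.one_re, Complex.zero_re] at this
    linarith
  have e0 : (fun x : ℝ => Delta510 L₂ t₀ x * (x : ℂ) ^ (s - 1))
      = fun x : ℝ => phaseInt 0 L₂ t₀ x * (x : ℂ) ^ (s - 1) := by
    funext x; rw [phaseInt_zero]
  have h1 := integral_phaseInt_mul_cpow_eq hL t₀ 0 hs
  have h2 := integral_phaseInt_mul_cpow_eq hL t₀ 1 (s := s + 1)
    (by rw [Complex.add_re, Complex.one_re]; linarith)
  simp only [add_sub_cancel_right] at h2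
  rw [delta514, e0, h1, h2]
  field_simp

/-- `x^t ≤ x^p + x^q` for `x > 0` and `p ≤ t ≤ q`. [folklore] -/
private lemma rpow_le_rpow_add_rpow {x p q t : ℝ} (hx : 0 < x) (hpt : p ≤ t) (htq : t ≤ q) :
    x ^ t ≤ x ^ p + x ^ q := by
  rcases le_or_gt 1 x with h1 | h1
  · have := Real.rpow_le_rpow_of_exponent_le h1 htq
    linarith [Real.rpow_nonneg hx.le p]
  · have := Real.rpow_le_rpow_of_exponent_ge hx h1.le hpt
    linarith [Real.rpow_nonneg hx.le q]

/-- `‖s‖ ≤ ‖s + 1‖` when `σ ≥ −1/2`. [folklore] -/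
private lemma norm_le_norm_add_one {s : ℂ} (hs : -1 / 2 ≤ s.re) : ‖s‖ ≤ ‖s + 1‖ := by
  have h1 : ‖s‖ ^ 2 ≤ ‖s + 1‖ ^ 2 := by
    rw [Complex.sq_norm, Complex.sq_norm, Complex.normSq_apply, Complex.normSq_apply]
    simp only [Complex.add_re, Complex.one_re, Complex.add_im, Complex.one_im, add_zero]
    nlinarith
  exact (pow_le_pow_iff_left₀ (norm_nonneg _) (norm_nonneg _) two_ne_zero).mp h1

/-- **Lemma 5.4 (i), structural form**: "If `1/2 ≤ σ ≤ 2`, then `δ(s) ≪ 𝓛^c|s|^{−2}`" — here, for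
`L₂ ≥ 1` and `1/2 ≤ σ ≤ 2`,
`‖δ(s)‖ ≤ K/‖s‖²` with the explicit `K = ∫₀^∞ ‖Δ″(x)‖(x^{3/2} + x³) dx < ∞` (independent of `s`;
its size `𝓛^c` under the manuscript's parameter values is not asserted here).
[cite: Zhang2022LandauSiegel, §5 Lemma 5.4 (i)] -/
theorem norm_delta514_le {L₂ : ℝ} (hL : 1 ≤ L₂) (t₀ : ℝ) {s : ℂ} (hσ1 : 1 / 2 ≤ s.re)
    (hσ2 : s.re ≤ 2) :
    ‖delta514 L₂ t₀ s‖
      ≤ (∫ x in Ioi (0 : ℝ), ‖phaseInt 2 L₂ t₀ x‖ * (x ^ (3 / 2 : ℝ) + x ^ (3 : ℝ))) / ‖s‖ ^ 2 := by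
  have hL0 : 0 < L₂ := by linarith
  have hs : 0 < s.re := by linarith
  have hs0 : s ≠ 0 := fun h => by rw [h, Complex.zero_re] at hs; exact lt_irrefl _ hs
  have hns : 0 < ‖s‖ := norm_pos_iff.mpr hs0
  have hns1 : ‖s‖ ≤ ‖s + 1‖ := norm_le_norm_add_one (by linarith)
  -- integrability of the majorant
  have hI1 := integrableOn_norm_phaseInt_mul_rpow hL t₀ 2 (a := 3 / 2 + 1) (by norm_num)
  have hI2 := integrableOn_norm_phaseInt_mul_rpow hL t₀ 2 (a := 3 + 1) (by norm_num)
  simp only [add_sub_cancel_right] at hI1 hI2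
  have hmaj : IntegrableOn
      (fun x : ℝ => ‖phaseInt 2 L₂ t₀ x‖ * (x ^ (3 / 2 : ℝ) + x ^ (3 : ℝ))) (Ioi 0) :=
    (hI1.add hI2).congr (Eventually.of_forall fun x => by simp only [Pi.add_apply]; ring)
  have hint := integrableOn_phaseInt_mul_cpow hL t₀ 2 (s := s + 1 + 1)
    (by rw [Complex.add_re, Complex.add_re, Complex.one_re]; linarith)
  simp only [add_sub_cancel_right] at hint
  have hbound : ‖∫ x in Ioi (0 : ℝ), phaseInt 2 L₂ t₀ x * (x : ℂ) ^ (s + 1)‖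
      ≤ ∫ x in Ioi (0 : ℝ), ‖phaseInt 2 L₂ t₀ x‖ * (x ^ (3 / 2 : ℝ) + x ^ (3 : ℝ)) := by
    calc ‖∫ x in Ioi (0 : ℝ), phaseInt 2 L₂ t₀ x * (x : ℂ) ^ (s + 1)‖
        ≤ ∫ x in Ioi (0 : ℝ), ‖phaseInt 2 L₂ t₀ x * (x : ℂ) ^ (s + 1)‖ :=
          norm_integral_le_integral_norm _
      _ ≤ ∫ x in Ioi (0 : ℝ), ‖phaseInt 2 L₂ t₀ x‖ * (x ^ (3 / 2 : ℝ) + x ^ (3 : ℝ)) := by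
          refine setIntegral_mono_on hint.norm hmaj measurableSet_Ioi fun x hx => ?_
          rw [norm_mul, Complex.norm_cpow_eq_rpow_re_of_pos hx, Complex.add_re, Complex.one_re]
          exact mul_le_mul_of_nonneg_left
            (rpow_le_rpow_add_rpow hx (by linarith) (by linarith)) (norm_nonneg _)
  have hK0 : 0 ≤ ∫ x in Ioi (0 : ℝ), ‖phaseInt 2 L₂ t₀ x‖ * (x ^ (3 / 2 : ℝ) + x ^ (3 : ℝ)) :=
    setIntegral_nonneg measurableSet_Ioi fun x hx => by
      have hx' : (0 : ℝ) < x := hx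
      positivity
  rw [delta514_eq hL t₀ hs, norm_mul, norm_div, norm_one, norm_mul]
  calc 1 / (‖s‖ * ‖s + 1‖) * ‖∫ x in Ioi (0 : ℝ), phaseInt 2 L₂ t₀ x * (x : ℂ) ^ (s + 1)‖
      ≤ 1 / (‖s‖ * ‖s‖)
        * ∫ x in Ioi (0 : ℝ), ‖phaseInt 2 L₂ t₀ x‖ * (x ^ (3 / 2 : ℝ) + x ^ (3 : ℝ)) := by
        gcongr
    _ = (∫ x in Ioi (0 : ℝ), ‖phaseInt 2 L₂ t₀ x‖ * (x ^ (3 / 2 : ℝ) + x ^ (3 : ℝ))) / ‖s‖ ^ 2 := by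
        rw [sq]; ring

end Lemma53

end Literature.NumberTheory.LFunctions.Zhang2022
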